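import Summits.QuantumAdvantage.QuantumAdvantage.Theorems.CubicForrelationNearExactIsExactTwelveLevelSixPrep

/-!
# Crux `CubicForrelation.NearExactIsExact` (stmt-QuantumAdvantage-14043) — n = 12, INSIDE the open window: a level-`≥ 6` side with
  `Φ ≥ 953/1024` is exact unless `Φ = 954/1024`

Certificate seat `b2b-cforr-cert` (gen 13).  HONEST FRAMING: a kernel-checked THEOREM (standard axioms) about cubic Boolean pairs on 12 bits,
strictly inside the open window `θ₁₂ ∈ [57/64, 15/16)`; one of the two type-E branches of the theorem "`Φ ≥ 955/1024 ⇒ Φ = 1` on 12 bits"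
(`…TwelveWindow955.lean`).  NOT summit progress.

THEOREM `tw6_levelSix_window`: cubic `f, g : 𝔽₂¹² → 𝔽₂`, `W_g = 64·u''` (every Walsh value of `g` in `64ℤ`), `Φ(f,g) ≥ 953/1024` and
`Φ(f,g) ≠ 477/512` ⇒ `Φ(f,g) = 1`.  (The tree had the boundary case `Φ ≥ 15/16 ⇒ Φ = 1`, `tw12_levelSix_ge`.)

## Proof (`s = (−1)^f`, `e = u'' − s`, `B := Σ e² = 8192(1 − Φ)`; `Φ ∈ [953/1024, 15/16)` means `512 < B ≤ 568`)
* Parseval `Σ u''² = 4096`: if every `u''` is odd then `|u''| = 1`, `g` is bent and `Φ ∈ {1} ∪ [0, 7/8]` (Hou + Reed–Muller, `tw_bent_end`).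
* Otherwise `Z = {u'' even}` (complement of the cubic parity `[u'' odd]`, `stub_walshTower`) is non-empty, costs `≥ 1` per point, so
  `512 ≤ #Z ≤ 568 < 768`: by the second weight of `RM(3,12)` (`sw_cubic_second_weight`) `#Z = 512` and `Z` is a 9-flat `x_Z ⊕ V₀`
  (`mw_flat_of_minweight`).  Hence `Σ_{x∉Z} e² ≤ 56` and `Σ_{Z}(e² − 1) ≤ 56`.
* `tw6_off_flat`: `e = 0` off `Z`; `tw6_H34`: (H3) `4 ∣ Σ_{3-flat} e`, (H4) `8 ∣ Σ_{4-flat} e` inside `Z`.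
* On `Z`, `e` is odd: `e = σ + 4λ` with the SIGN `σ = ±1 ≡ e (mod 4)` and the WILD part `λ`.  (H3) gives `4 ∣ Σ_{3-flat} σ`, so by `fr_hsd`
  the Boolean `h = [σ = −1]` has base-free second differences `B(p,q)` along `Z` ("`h` is quadratic on the flat"), and then
  (`ws_sum4_mod8`, a 2¹¹-case kernel computation) every 4-flat sum of `σ` is `≡ 4·Pf (mod 8)` with `Pf` the Pfaffian of the Gram matrix
  `B(aᵢ,aⱼ)` — independent of the base point.  With (H4): the parity of `Σ_{4-flat} λ` equals `Pf` for EVERY base point in `Z`.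
* The odd set `L = {λ odd}` has `≤ 7` points (each costs `e² − 1 ≥ 8`).  If some direction 4-tuple had `Pf = 1`, every base point would see
  an odd `λ` on its flat, so `Z ⊆ ⋃_ε (L ⊕ a_ε)` and `512 ≤ 16·#L ≤ 112` — absurd.  So all 4-flat sums of `λ` are even and by the
  Reed–Muller distance on the abstract 9-flat (`ws_erm_round`, `r = 3`) `#L ≥ 64` or `L = ∅`: `λ` is even on `Z`.
* A point with `λ ≠ 0` now has `|λ| ≥ 2`, `|e| ≥ 7`, cost `e² − 1 ≥ 48`; two such cost `96 > 56`.  So `B − 512 ∈ {0} ∪ {48}` (`|e| = 7`;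
  `|e| = 9` costs `80 > 56`), i.e. `Φ ∈ {15/16, 477/512}` — both excluded.
What it does NOT do: `Φ = 954/1024 = 477/512` with a single wild point of height `|e| = 7` on the 9-flat is not excluded by this file (it is
irrelevant above `955/1024`); nothing here is uniform in `n`.

References: J. Ax (1964) / R. J. McEliece (1972); X.-D. Hou (1998); T. Kasami, N. Tokura (1970); MacWilliams–Sloane (1977) Ch. 13–15;
C. Carlet (2021) §5.2.  Everything below is proved from Mathlib and the tree; axioms are the standard three.
-/

set_option linter.dupNamespace false -- D-0017: single-problem summit ⇒ `QuantumAdvantage.QuantumAdvantage` by design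

noncomputable section

namespace Summit.QuantumAdvantage.QuantumAdvantage.Theorems.CubicForrelation.NearExactIsExact

open Finset
open Literature.Computability.QuantumComplexity
open Literature.Computability.QuantumComplexity.BuzetChailloux (bxor zeroVec bxor_bxor_cancel_left bxor_zeroVec zeroVec_bxor bxor_comm
  bxor_self)
open Literature.Computability.QuantumComplexity.DerivativeWalsh (W)

/-! ### The theorem -/

/-- **Level `≥ 6` on 12 bits: `Φ ≥ 953/1024 ⇒ Φ = 1` unless `Φ = 954/1024`.**  For cubic `f, g : 𝔽₂¹² → 𝔽₂` with `W_g = 64·u''`,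
`Φ(f,g) ≥ 953/1024` and `Φ(f,g) ≠ 477/512` the pair is exact.  Finite-slice statement; NOT summit progress. [this work] -/
theorem tw6_levelSix_window (f g : (Fin (6 + 6) → Bool) → Bool) (hf : IsDegLeFun 3 f) (hg : IsDegLeFun 3 g)
    (u'' : (Fin (6 + 6) → Bool) → ℤ) (hu'' : ∀ x, W (fun y => signOf (g y)) x = (2 : ℝ) ^ 6 * (u'' x : ℝ))
    (hΦ : (953 / 1024 : ℝ) ≤ forrelation f g) (h954 : forrelation f g ≠ 477 / 512) : forrelation f g = 1 := by
  classical
  by_cases h1516 : (15 / 16 : ℝ) ≤ forrelation f g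
  · exact tw12_levelSix_ge f g hf hg u'' hu'' h1516
  exfalso
  push Not at h1516
  -- `u = 4u''` at the Ax level `4`
  set u : (Fin (6 + 6) → Bool) → ℤ := fun x => 4 * u'' x with hudef
  have hu : ∀ x, W (fun y => signOf (g y)) x = (2 : ℝ) ^ 4 * (u x : ℝ) := by
    intro x; rw [hu'' x]; simp only [u]; push_cast; ring
  -- the residual `e = u'' − s` and its budget `B = Σ e² = 8192(1 − Φ) ∈ (512, 568] \ {560}`
  set e : (Fin (6 + 6) → Bool) → ℤ := fun x => u'' x - sZ (f x) with hedef
  have hFe : ∀ y, u y - 4 * sZ (f y) = 4 * e y := fun y => by simp only [u, e]; ring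
  have hbud := tw12_budget f g u hu
  have h16 : ∀ x, (u x - 4 * sZ (f x)) ^ 2 = 16 * e x ^ 2 := fun x => by rw [hFe]; ring
  have hBR : ((∑ x, e x ^ 2 : ℤ) : ℝ) = 8192 * (1 - forrelation f g) := by
    have h' : ((∑ x, (u x - 4 * sZ (f x)) ^ 2 : ℤ) : ℝ) = 16 * ((∑ x, e x ^ 2 : ℤ) : ℝ) := by
      rw [sum_congr rfl fun x _ => h16 x, ← mul_sum]; push_cast; ring
    rw [h'] at hbud
    linarith
  have hB_le : (∑ x, e x ^ 2 : ℤ) ≤ 568 := by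
    have h' : ((∑ x, e x ^ 2 : ℤ) : ℝ) ≤ 568 := by rw [hBR]; linarith
    exact_mod_cast h'
  have hB_gt : 512 < (∑ x, e x ^ 2 : ℤ) := by
    have h' : (512 : ℝ) < ((∑ x, e x ^ 2 : ℤ) : ℝ) := by rw [hBR]; linarith
    exact_mod_cast h'
  have hB_ne : (∑ x, e x ^ 2 : ℤ) ≠ 560 := by
    intro h560
    have h' : ((∑ x, e x ^ 2 : ℤ) : ℝ) = 560 := by exact_mod_cast h560
    rw [hBR] at h'
    apply h954
    linarith
  -- even points of `u''` cost `≥ 1`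
  set Z := univ.filter (fun x : Fin (6 + 6) → Bool => ¬ Odd (u'' x)) with hZdef
  have hmemZ : ∀ x, x ∈ Z ↔ ¬ Odd (u'' x) := fun x => by simp [hZdef]
  have heodd : ∀ x, x ∈ Z → Odd (e x) := by
    intro x hx
    have hev := Int.not_odd_iff_even.1 ((hmemZ x).1 hx)
    rcases tp_sZ_cases (f x) with hs | hs <;> simp only [e] <;> rw [hs]
    · exact Int.odd_sub.2 (iff_of_false (Int.not_odd_iff_even.2 hev) (by decide))
    · exact Int.odd_sub.2 (iff_of_false (Int.not_odd_iff_even.2 hev) (by decide))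
  have heeven : ∀ x, x ∉ Z → Even (e x) := by
    intro x hx
    have hodd : Odd (u'' x) := not_not.1 fun h => hx ((hmemZ x).2 h)
    rcases tp_sZ_cases (f x) with hs | hs <;> simp only [e] <;> rw [hs]
    · exact Int.even_sub.2 (iff_of_false (Int.not_even_iff_odd.2 hodd) (by decide))
    · exact Int.even_sub.2 (iff_of_false (Int.not_even_iff_odd.2 hodd) (by decide))
  have hsq1 : ∀ x, x ∈ Z → 1 ≤ e x ^ 2 := by
    intro x hx
    have h0 := Int.odd_iff.1 (heodd x hx)
    have : e x ≤ -1 ∨ 1 ≤ e x := by omega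
    have := tp_sq_ge (k := 1) (by norm_num) this
    linarith
  have hsplit : (∑ x, e x ^ 2 : ℤ) = ∑ x ∈ Z, e x ^ 2 + ∑ x ∈ univ.filter (fun x => x ∉ Z), e x ^ 2 := by
    rw [← sum_filter_add_sum_filter_not univ (fun x => x ∈ Z)]
    congr 1
    exact sum_congr (by ext x; simp) fun _ _ => rfl
  have hZle : (#Z : ℤ) ≤ 568 := by
    have h1 : (#Z : ℤ) = ∑ x ∈ Z, (1 : ℤ) := by rw [sum_const, nsmul_eq_mul, mul_one]
    have h2 : ∑ x ∈ Z, (1 : ℤ) ≤ ∑ x ∈ Z, e x ^ 2 := sum_le_sum fun x hx => hsq1 x hx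
    have h3 : 0 ≤ ∑ x ∈ univ.filter (fun x => x ∉ Z), e x ^ 2 := sum_nonneg fun x _ => sq_nonneg _
    linarith
  -- Parseval at level 6: `Σ u''² = 4096`
  have hpar : ∑ x, u'' x ^ 2 = 4096 := by
    have h := zms_sum_u_sq 2 g u (fun x => (hu x).trans (by norm_num))
    have e : ∑ x, ((u x : ℝ)) ^ 2 = 16 * ∑ x, ((u'' x : ℝ)) ^ 2 := by
      rw [mul_sum]; exact sum_congr rfl fun x _ => by simp only [u]; push_cast; ring
    rw [e] at h
    norm_num at h
    have h' : ∑ x, ((u'' x : ℝ)) ^ 2 = 4096 := by linarith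
    exact_mod_cast h'
  by_cases hall : ∀ x, Odd (u'' x)
  · -- every `u''` odd: `g` is bent, `Φ = 1` or `Φ ≤ 7/8`
    have hsq1' : ∀ x, u'' x ^ 2 = 1 := by
      have hge : ∀ x, (1 : ℤ) ≤ u'' x ^ 2 := fun x => by
        have h0 := Int.odd_iff.1 (hall x)
        have : u'' x ≤ -1 ∨ 1 ≤ u'' x := by omega
        have := tp_sq_ge (k := 1) (by norm_num) this
        linarith
      have hsum0 : ∑ x, (u'' x ^ 2 - 1 : ℤ) = 0 := by
        rw [sum_sub_distrib, hpar, sum_const, card_univ, Fintype.card_fun, Fintype.card_bool, Fintype.card_fin]; norm_num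
      intro x
      have := (sum_eq_zero_iff_of_nonneg fun y _ => by have := hge y; linarith).1 hsum0 x (mem_univ x)
      linarith
    have hbent : ∀ x, W (fun y => signOf (g y)) x ^ 2 = (2 : ℝ) ^ (6 + 6) := by
      intro x
      rw [hu'' x, mul_pow]
      have : ((u'' x : ℝ)) ^ 2 = 1 := by exact_mod_cast hsq1' x
      rw [this]; norm_num
    rcases tw_bent_end (by norm_num) f g hf hg hbent with h | h
    · rw [h] at h1516; norm_num at h1516
    · norm_num at h; linarith
  push Not at hall
  obtain ⟨x₁, hx₁⟩ := hall
  -- the parity of `u''` is cubic; `Z` has exactly `512` points and is a 9-flat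
  have hp : IsDegLeFun 3 (fun x => decide (Odd (u'' x))) :=
    stub_walshTower stub_axParity (6 + 6) 6 3 g u'' hg hu'' (by intro k hk hkn; omega)
  have hp' : IsDegLeFun (2 + 1) (fun x => decide (Odd (u'' x)) ^^ true) := tb_isDegLeFun_xor_const hp true
  have hfilt : (univ.filter fun x : Fin (6 + 6) → Bool => (decide (Odd (u'' x)) ^^ true) = true) = Z :=
    filter_congr fun x _ => by simp
  have hne : ∃ x, (decide (Odd (u'' x)) ^^ true) = true := ⟨x₁, by simpa using hx₁⟩
  have hRM := bb_rmWeight_holds (6 + 6) 3 (fun x => decide (Odd (u'' x)) ^^ true) hp' hne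
  rw [hfilt] at hRM
  have hZge : 512 ≤ #Z := by norm_num at hRM; omega
  have hZcard : #Z = 512 := by
    have hZle' : #Z ≤ 568 := by exact_mod_cast hZle
    have hsw := sw_cubic_second_weight (m := 6 + 6) _ hp' hne (by rw [hfilt]; norm_num; omega)
    rw [hfilt] at hsw
    norm_num at hsw
    omega
  have hmw := mw_flat_of_minweight 2 (fun x => decide (Odd (u'' x)) ^^ true) hp' (by rw [hfilt, hZcard]; norm_num)
  rw [hfilt] at hmw
  obtain ⟨h0, hadd, hcardV, hcoset⟩ := hmw
  set V₀ := univ.filter (fun a : Fin (6 + 6) → Bool => ∀ x,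
    (decide (Odd (u'' (bxor x a))) ^^ true) = (decide (Odd (u'' x)) ^^ true)) with hV₀
  obtain ⟨xZ, hxZ⟩ : Z.Nonempty := card_pos.1 (by rw [hZcard]; norm_num)
  have hS : Z = V₀.image (bxor xZ) := hcoset xZ (by have h := (hmemZ xZ).1 hxZ; simpa using h)
  rw [hZcard] at hcardV
  have hcardV9 : #V₀ = 2 ^ 9 := by rw [hcardV]; norm_num
  have hPV : ∀ x, x ∈ Z → ∀ a ∈ V₀, bxor x a ∈ Z := fun x hx a ha => fl1_coset_vadd hadd hS hx ha
  have hPV' : ∀ x, x ∉ Z → ∀ a ∈ V₀, bxor x a ∉ Z := fun x hx a ha => fl1_coset_out' hadd hS hx ha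
  -- budget split: `Σ_Z e² ≥ 512`, so off `Z` at most `56`, and `Σ_Z (e² − 1) ≤ 56`
  have hZsum_ge : (512 : ℤ) ≤ ∑ x ∈ Z, e x ^ 2 := by
    have h1 : ∑ x ∈ Z, (1 : ℤ) ≤ ∑ x ∈ Z, e x ^ 2 := sum_le_sum fun x hx => hsq1 x hx
    rw [sum_const, nsmul_eq_mul, mul_one, hZcard] at h1
    exact_mod_cast h1
  have hoff_le : ∑ x ∈ univ.filter (fun x => x ∉ Z), e x ^ 2 ≤ 56 := by linarith
  have hon_le : ∑ x ∈ Z, (e x ^ 2 - 1) ≤ 56 := by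
    rw [sum_sub_distrib, sum_const, nsmul_eq_mul, mul_one, hZcard]
    have h3 : 0 ≤ ∑ x ∈ univ.filter (fun x => x ∉ Z), e x ^ 2 := sum_nonneg fun x _ => sq_nonneg _
    push_cast
    linarith
  -- the residual vanishes off `Z` (`tw6_off_flat`), and (H3)/(H4) hold on `Z` (`tw6_H34`)
  have hoff0 : ∀ y, y ∉ Z → e y = 0 := tw6_off_flat f g hf hg u'' hu'' V₀ xZ h0 hadd hcardV9 hS hoff_le
  obtain ⟨H3, H4⟩ := tw6_H34 f g hf hg u'' hu'' V₀ xZ h0 hadd hcardV hS hoff0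
  replace H3 : ∀ x ∈ Z, ∀ a b c : Fin (6 + 6) → Bool, a ∈ V₀ → b ∈ V₀ → c ∈ V₀ →
      (4 : ℤ) ∣ ∑ ε : Fin 3 → Bool, e (fun j => x j ^^ decide (Odd #(univ.filter fun i =>
        ε i && (![a, b, c] : Fin 3 → Fin (6 + 6) → Bool) i j))) := H3
  replace H4 : ∀ x ∈ Z, ∀ a₀ a₁ a₂ a₃ : Fin (6 + 6) → Bool, a₀ ∈ V₀ → a₁ ∈ V₀ → a₂ ∈ V₀ → a₃ ∈ V₀ →
      (8 : ℤ) ∣ ∑ ε : Fin 4 → Bool, e (fun j => x j ^^ decide (Odd #(univ.filter fun i =>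
        ε i && (![a₀, a₁, a₂, a₃] : Fin 4 → Fin (6 + 6) → Bool) i j))) := H4

  -- the sign `σ = sZ ∘ hb ≡ e (mod 4)` and the wild part `λ = (e − σ)/4` on `Z`
  set hb : (Fin (6 + 6) → Bool) → Bool := fun x => decide (e x % 4 = 3) with hhb
  set lam : (Fin (6 + 6) → Bool) → ℤ := fun x => (e x - sZ (hb x)) / 4 with hlam
  have hdec : ∀ x, x ∈ Z → e x = sZ (hb x) + 4 * lam x := by
    intro x hx
    have h0 := Int.odd_iff.1 (heodd x hx)
    have hmod : e x % 4 = 1 ∨ e x % 4 = 3 := by omega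
    have h4 : (4 : ℤ) ∣ e x - sZ (hb x) := by
      rcases hmod with h1 | h3
      · have hsz : sZ (hb x) = 1 := by simp [hb, h1, sZ]
        rw [hsz]; omega
      · have hsz : sZ (hb x) = -1 := by simp [hb, h3, sZ]
        rw [hsz]; omega
    have := Int.mul_ediv_cancel' h4
    simp only [lam]
    linarith
  -- (H3) for the sign pattern and base-free second differences
  have H3σ : ∀ x, x ∈ Z → ∀ a b c : Fin (6 + 6) → Bool, a ∈ V₀ → b ∈ V₀ → c ∈ V₀ →
      (4 : ℤ) ∣ ∑ ε : Fin 3 → Bool, sZ (hb (fun j => x j ^^ decide (Odd #(univ.filter fun i =>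
        ε i && (![a, b, c] : Fin 3 → Fin (6 + 6) → Bool) i j)))) := by
    intro x hx a b c ha hb' hc
    have hin : ∀ ε : Fin 3 → Bool, (fun j => x j ^^ decide (Odd #(univ.filter fun i =>
        ε i && (![a, b, c] : Fin 3 → Fin (6 + 6) → Bool) i j))) ∈ Z :=
      fun ε => fr_mem_flatPt3 V₀ h0 (· ∈ Z) hPV hx ![a, b, c] (fun i => by fin_cases i <;> assumption) ε
    have h := H3 x hx a b c ha hb' hc
    rw [sum_congr rfl fun ε _ => hdec _ (hin ε), sum_add_distrib, ← mul_sum] at h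
    obtain ⟨k, hk⟩ := h
    exact ⟨k - ∑ ε : Fin 3 → Bool, lam (fun j => x j ^^ decide (Odd #(univ.filter fun i =>
        ε i && (![a, b, c] : Fin 3 → Fin (6 + 6) → Bool) i j))), by linarith⟩
  have hVP : ∀ x, x ∈ Z → bxor xZ x ∈ V₀ := fun x hx => fl1_coset_diff hS hx
  have hsd := fr_hsd V₀ (· ∈ Z) xZ hxZ hVP hb H3σ
  -- (H4) and the Pfaffian: the parity of a 4-flat sum of `λ` does not depend on the base point
  have hPf : ∀ x, x ∈ Z → ∀ a : Fin 4 → Fin (6 + 6) → Bool, (∀ i, a i ∈ V₀) →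
      ((2 : ℤ) ∣ ∑ ε : Fin 4 → Bool, lam (fun j => x j ^^ decide (Odd #(univ.filter fun i => ε i && a i j))) ↔
        ¬ ((((hb xZ ^^ hb (bxor xZ (a 1)) ^^ hb (bxor xZ (a 0)) ^^ hb (bxor (bxor xZ (a 1)) (a 0))) &&
            (hb xZ ^^ hb (bxor xZ (a 3)) ^^ hb (bxor xZ (a 2)) ^^ hb (bxor (bxor xZ (a 3)) (a 2)))) ^^
          ((hb xZ ^^ hb (bxor xZ (a 2)) ^^ hb (bxor xZ (a 0)) ^^ hb (bxor (bxor xZ (a 2)) (a 0))) &&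
            (hb xZ ^^ hb (bxor xZ (a 3)) ^^ hb (bxor xZ (a 1)) ^^ hb (bxor (bxor xZ (a 3)) (a 1)))) ^^
          ((hb xZ ^^ hb (bxor xZ (a 3)) ^^ hb (bxor xZ (a 0)) ^^ hb (bxor (bxor xZ (a 3)) (a 0))) &&
            (hb xZ ^^ hb (bxor xZ (a 2)) ^^ hb (bxor xZ (a 1)) ^^ hb (bxor (bxor xZ (a 2)) (a 1))))) = true)) := by
    intro x hx a ha
    have ea : a = ![a 0, a 1, a 2, a 3] := by funext i; fin_cases i <;> rfl
    have hin : ∀ ε : Fin 4 → Bool, (fun j => x j ^^ decide (Odd #(univ.filter fun i => ε i && a i j))) ∈ Z :=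
      fun ε => fr_mem_flatPt4 V₀ h0 (· ∈ Z) hPV hx a ha ε
    have h8 := H4 x hx (a 0) (a 1) (a 2) (a 3) (ha 0) (ha 1) (ha 2) (ha 3)
    rw [← ea] at h8
    rw [sum_congr rfl fun ε _ => hdec _ (hin ε), sum_add_distrib, ← mul_sum] at h8
    have hm8 := ws_sum4_mod8 V₀ (· ∈ Z) xZ hb hPV hsd hx (ha 0) (ha 1) (ha 2) (ha 3)
    rw [← ea] at hm8
    constructor
    · intro h2 hpf
      rw [if_pos hpf] at hm8
      obtain ⟨k, hk⟩ := h8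
      obtain ⟨k2, hk2⟩ := h2
      omega
    · intro hpf
      rw [if_neg hpf] at hm8
      obtain ⟨k, hk⟩ := h8
      exact ⟨k - (∑ ε : Fin 4 → Bool, sZ (hb (fun j => x j ^^ decide (Odd #(univ.filter fun i =>
        ε i && a i j))))) / 8, by omega⟩
  -- the odd set `L` of `λ` on `Z` has at most `7` points (each costs `e² − 1 ≥ 8`)
  set L := Z.filter (fun x => Odd (lam x)) with hLdef
  have hcost8 : ∀ x, x ∈ Z → Odd (lam x) → 8 ≤ e x ^ 2 - 1 := by
    intro x hx hodd
    have hd := hdec x hx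
    have h0 := Int.odd_iff.1 hodd
    rcases tp_sZ_cases (hb x) with hs | hs <;> rw [hs] at hd
    · have : e x ≤ -3 ∨ 3 ≤ e x := by omega
      have := tp_sq_ge (k := 3) (by norm_num) this; linarith
    · have : e x ≤ -3 ∨ 3 ≤ e x := by omega
      have := tp_sq_ge (k := 3) (by norm_num) this; linarith
  have hL7 : (#L : ℤ) ≤ 7 := by
    have h1 : ∑ x ∈ L, (8 : ℤ) ≤ ∑ x ∈ L, (e x ^ 2 - 1) :=
      sum_le_sum fun x hx => hcost8 x (mem_filter.1 hx).1 (mem_filter.1 hx).2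
    have h2 : ∑ x ∈ L, (e x ^ 2 - 1) ≤ ∑ x ∈ Z, (e x ^ 2 - 1) :=
      sum_le_sum_of_subset_of_nonneg (filter_subset _ _) (fun x hx _ => by have := hsq1 x hx; linarith)
    rw [sum_const, nsmul_eq_mul] at h1
    linarith
  -- every 4-flat sum of `λ` on `Z` is even (otherwise `Z` is covered by sixteen translates of `L`)
  have hLeven : ∀ x, x ∈ Z → ∀ a : Fin 4 → Fin (6 + 6) → Bool, (∀ i, a i ∈ V₀) →
      (2 : ℤ) ∣ ∑ ε : Fin 4 → Bool, lam (fun j => x j ^^ decide (Odd #(univ.filter fun i => ε i && a i j))) := by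
    intro x hx a ha
    by_contra hodd
    have hPfa := fun hn => hodd ((hPf x hx a ha).2 hn)
    have hall : ∀ y, y ∈ Z → ¬ (2 : ℤ) ∣ ∑ ε : Fin 4 → Bool, lam (fun j => y j ^^ decide (Odd #(univ.filter fun i =>
        ε i && a i j))) := fun y hy h2 => (hPf y hy a ha).1 h2 (not_not.1 hPfa)
    have hex : ∀ y, y ∈ Z → ∃ ε : Fin 4 → Bool, Odd (lam (fun j => y j ^^ decide (Odd #(univ.filter fun i =>
        ε i && a i j)))) := by
      intro y hy
      by_contra hnone
      push Not at hnone
      exact hall y hy (dvd_sum fun ε _ => even_iff_two_dvd.1 (Int.not_odd_iff_even.1 (hnone ε)))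
    have hv : ∀ ε : Fin 4 → Bool, (fun j => zeroVec j ^^ decide (Odd #(univ.filter fun i => ε i && a i j))) ∈ V₀ :=
      fun ε => ws_flatPt_mem V₀ h0 (· ∈ V₀) (fun y hy b hb' => hadd y hy b hb') 4 zeroVec h0 a ha ε
    have hcover : Z ⊆ (univ : Finset (Fin 4 → Bool)).biUnion (fun ε => Z.filter fun y =>
        Odd (lam (bxor y (fun j => zeroVec j ^^ decide (Odd #(univ.filter fun i => ε i && a i j)))))) := by
      intro y hy
      obtain ⟨ε, hε⟩ := hex y hy
      rw [ws_flatPt_eq_bxor] at hε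
      exact mem_biUnion.2 ⟨ε, mem_univ _, mem_filter.2 ⟨hy, hε⟩⟩
    have hcard := (card_le_card hcover).trans card_biUnion_le
    rw [sum_congr rfl fun ε _ => ws_card_translate V₀ Z xZ hadd hS (hv ε) (fun y => Odd (lam y)), sum_const, card_univ,
      Fintype.card_fun, Fintype.card_bool, Fintype.card_fin, smul_eq_mul, hZcard] at hcard
    have : (512 : ℤ) ≤ 16 * #L := by exact_mod_cast hcard
    linarith
  -- Reed–Muller on the coset: `λ` is even on `Z`
  have hlam_even : ∀ x, x ∈ Z → Even (lam x) := by
    rcases ws_erm_round V₀ h0 hadd hcardV9 xZ lam 3 (fun b hb' a ha => hLeven b (by rwa [hS]) a ha) with hev | hbig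
    · intro x hx; exact hev x (by rwa [← hS])
    · exfalso
      rw [← hS] at hbig
      have hbig' : 2 ^ 9 ≤ 2 ^ 3 * #L := hbig
      have : (64 : ℤ) ≤ #L := by exact_mod_cast (by norm_num at hbig'; omega)
      linarith
  -- final count: a non-zero (even) `λ` costs `e² − 1 ≥ 48`, so at most one, and then `B ∈ {512, 560}`
  have habs7 : ∀ x, x ∈ Z → lam x ≠ 0 → e x ≤ -7 ∨ 7 ≤ e x := by
    intro x hx hne
    obtain ⟨k, hk⟩ := hlam_even x hx
    have hd := hdec x hx
    rcases tp_sZ_cases (hb x) with hs | hs <;> rw [hs] at hd <;> omega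
  have hcost48 : ∀ x, x ∈ Z → lam x ≠ 0 → 48 ≤ e x ^ 2 - 1 := by
    intro x hx hne
    have := tp_sq_ge (k := 7) (by norm_num) (habs7 x hx hne); linarith
  have hzero1 : ∀ x, x ∈ Z → lam x = 0 → e x ^ 2 - 1 = 0 := by
    intro x hx hl
    have hd := hdec x hx
    rw [hl] at hd
    rcases tp_sZ_cases (hb x) with hs | hs <;> rw [hs] at hd <;> rw [hd] <;> norm_num
  set T := Z.filter (fun x => lam x ≠ 0) with hTdef
  have hDT : ∑ x ∈ Z, (e x ^ 2 - 1) = ∑ x ∈ T, (e x ^ 2 - 1) := by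
    refine (sum_subset (filter_subset _ Z) fun x hxZ hxT => ?_).symm
    have hn : ¬ (lam x ≠ 0) := fun hne => hxT (mem_filter.2 ⟨hxZ, hne⟩)
    exact hzero1 x hxZ (not_not.1 hn)
  have hT1 : #T ≤ 1 := by
    have h1 : ∑ x ∈ T, (48 : ℤ) ≤ ∑ x ∈ T, (e x ^ 2 - 1) :=
      sum_le_sum fun x hx => hcost48 x (mem_filter.1 hx).1 (mem_filter.1 hx).2
    rw [sum_const, nsmul_eq_mul, ← hDT] at h1
    have h2 : (#T : ℤ) * 48 ≤ 56 := by linarith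
    have h3 : (#T : ℤ) ≤ 1 := by omega
    exact_mod_cast h3
  have hoff0sum : ∑ x ∈ univ.filter (fun x => x ∉ Z), e x ^ 2 = 0 :=
    sum_eq_zero fun x hx => by rw [hoff0 x (mem_filter.1 hx).2]; norm_num
  have hZe : ∑ x ∈ Z, e x ^ 2 = 512 + ∑ x ∈ T, (e x ^ 2 - 1) := by
    rw [← hDT, sum_sub_distrib, sum_const, nsmul_eq_mul, mul_one, hZcard]; push_cast; ring
  rcases Nat.le_one_iff_eq_zero_or_eq_one.1 hT1 with hT0 | hT1'
  · have hTe : T = ∅ := card_eq_zero.1 hT0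
    rw [hTe, sum_empty] at hZe
    rw [hsplit, hZe, hoff0sum] at hB_gt
    norm_num at hB_gt
  · obtain ⟨x₀, hTx₀⟩ := card_eq_one.1 hT1'
    have hx₀T : x₀ ∈ T := by rw [hTx₀]; exact mem_singleton_self _
    have hx₀Z : x₀ ∈ Z := (mem_filter.1 hx₀T).1
    have hx₀l : lam x₀ ≠ 0 := (mem_filter.1 hx₀T).2
    rw [hTx₀, sum_singleton] at hZe
    rw [hsplit, hZe, hoff0sum] at hB_gt hB_le hB_ne
    have h7 := habs7 x₀ hx₀Z hx₀l
    have hle7 : -7 ≤ e x₀ ∧ e x₀ ≤ 7 := by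
      by_contra hc
      have h8 : e x₀ ≤ -8 ∨ 8 ≤ e x₀ := by omega
      have := tp_sq_ge (k := 8) (by norm_num) h8
      linarith
    have he7 : e x₀ = 7 ∨ e x₀ = -7 := by omega
    rcases he7 with h | h <;> rw [h] at hB_ne <;> norm_num at hB_ne

end Summit.QuantumAdvantage.QuantumAdvantage.Theorems.CubicForrelation.NearExactIsExact

end
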